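import Summits.CriticalPhenomena.PercolationContinuityZ3.Theorems.PercNearOneGluingNoHeavyLowerTailTformReferenceTransfer
import HarnessLib

/-!
# `NoHeavyLowerTail` (stmt-CriticalPhenomena-4575) — every observer: single-gate domination, QGATE-T at `|S| = 1`,
# and XZ at the champion whenever a relay K-dominates the gates

Support file (prover `prim-hp-5`, hull-port cell, T-form calculus, gen 3; `--supports stmt-CriticalPhenomena-4575`).
No definitions, no named facts, no sorries.  Notation of `…TformReferenceTransfer`: observer `o ∉ A` with ARBITRARY gates
(positive-weight neighbours, relays or not), `Φ_G` / `Φ_K` the lightness in `G` / in `K = G − o`, T-form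
`μ{1 ≤ N ≤ j} ≤ μ({|π(c)| ≤ j} ∩ {1 ≤ N})` (conclusion of the registered stub `stub_attachedChampion`).
All three are corollaries of the reference transfer `Theorems.tform_of_reference` and the K-domination atom
`Theorems.attachedChampion_of_gates_dominated`.

* `tform_of_lightestGate` — **SINGLE-GATE DOMINATION (SGD):** if `g` is a `K`-lightest gate of `o` and `c ≠ o` satisfies
  `Φ_G(g) ≤ Φ_G(c)`, then `c` is a T-form witness.  (Relay-neighboured observers: `SinglePortDomination.tform_of_dominates_lightestPort`,
  prover `prim-lf-8`.)
* `tform_of_gateDomination` — **QGATE-T at `|S| = 1`:** a vertex `c ≠ o` at least as `G`-light as EVERY gate of `o` is a T-form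
  witness.  The `|S| = 1` case of the gate-domination law of the ttrl census (`run/shared/lean/ttrl/tcs/README.md`, QGATE-T:
  0 violations / 67.9 M exact pairs, tight exactly when the observer is glued to the arg-max gate) — now a theorem for every
  finite weighted graph, every `A`, every level.
* `attachedChampion_of_relayGateDominator` — **XZ at the champion** for every observer `o ∉ A` admitting a relay `p` with
  `Φ_K(y) ≤ Φ_K(p)` for all gates `y` (e.g. a `K`-lightest gate is a relay, or the champion of `G − o` is at least as `K`-light
  as every non-relay gate): every level-`j` champion `q` satisfies `μ{1 ≤ N ≤ j} ≤ μ({|π(q)| ≤ j} ∩ {1 ≤ N})`.  In that regime the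
  observer-deleted form XZ-H (`Theorems.attachedChampion_of_gates_dominated`) thus upgrades to XZ with no transfer hypothesis
  (cf. the refuted `stub_transferAttached` and the open `stub_witnessTransfer` of `…AttachedChampionWitnessTransfer`).  The residual
  configuration of `stub_attachedChampion` is an observer with a non-relay gate strictly `K`-lighter than every relay.
-/

noncomputable section

namespace Summit.CriticalPhenomena.PercolationContinuityZ3.Theorems

open MeasureTheory Set Literature.Probability.LatticeModels Literature.Probability.Percolation
open scoped Classical BigOperators

variable {n : ℕ}

open CutObserver in
/-- **SINGLE-GATE DOMINATION (every observer).**  Let `o ∉ A`, let `g ≠ o` be at least as `K`-light as every positive-weight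
neighbour of `o` (`Φ_K(y) ≤ Φ_K(g)`; e.g. a `K`-lightest gate), and let `c ≠ o` satisfy `Φ_G(g) ≤ Φ_G(c)`.  Then
`μ{1 ≤ N ≤ j} ≤ μ({|π(c)| ≤ j} ∩ {1 ≤ N})`. [cite: VandenbergHaggstromKahn2005, Thm. 1.5 (p. 7)] -/
theorem tform_of_lightestGate (w : Sym2 (Fin n) → unitInterval) (A : Finset (Fin n)) (o g c : Fin n) (j : ℕ)
    (hoA : o ∉ A) (hgo : g ≠ o) (hco : c ≠ o)
    (hdom : ∀ y : Fin n, y ≠ o → w s(o, y) ≠ 0 →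
      (prodBernoulli w).real {ω : BondConfig (Fin n) |
          (A.filter fun z => (openGraph (ω ∩ {e | o ∉ e})).Reachable y z).card ≤ j} ≤
        (prodBernoulli w).real {ω : BondConfig (Fin n) |
          (A.filter fun z => (openGraph (ω ∩ {e | o ∉ e})).Reachable g z).card ≤ j})
    (hG : (prodBernoulli w).real {ω : BondConfig (Fin n) | (A.filter fun z => ω ∈ openConn g z).card ≤ j} ≤
      (prodBernoulli w).real {ω : BondConfig (Fin n) | (A.filter fun z => ω ∈ openConn c z).card ≤ j}) :
    (prodBernoulli w).real {ω : BondConfig (Fin n) |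
        1 ≤ (A.filter fun x => ω ∈ openConn o x).card ∧ (A.filter fun x => ω ∈ openConn o x).card ≤ j} ≤
      (prodBernoulli w).real {ω : BondConfig (Fin n) |
        (A.filter fun x => ω ∈ openConn c x).card ≤ j ∧ 1 ≤ (A.filter fun x => ω ∈ openConn o x).card} := by
  by_cases hKc : (prodBernoulli w).real {ω : BondConfig (Fin n) |
          (A.filter fun z => (openGraph (ω ∩ {e | o ∉ e})).Reachable c z).card ≤ j} ≤
        (prodBernoulli w).real {ω : BondConfig (Fin n) |
          (A.filter fun z => (openGraph (ω ∩ {e | o ∉ e})).Reachable g z).card ≤ j}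
  · exact tform_of_reference w A o g c j hoA hgo hco hdom hKc hG
  · push Not at hKc
    exact attachedChampion_of_gates_dominated w A o c j hoA hco fun y hyo hwy => (hdom y hyo hwy).trans hKc.le

open CutObserver in
/-- **QGATE-T at `|S| = 1` (every observer).**  Let `o ∉ A` have at least one positive-weight neighbour, and let `c ≠ o` be at
least as `G`-light as every positive-weight neighbour `y` of `o` (`μ{|π(y)| ≤ j} ≤ μ{|π(c)| ≤ j}`).  Then
`μ{1 ≤ N ≤ j} ≤ μ({|π(c)| ≤ j} ∩ {1 ≤ N})`: a vertex dominating the gates in lightness is a T-form witness.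
[cite: VandenbergHaggstromKahn2005, Thm. 1.5 (p. 7)] -/
theorem tform_of_gateDomination (w : Sym2 (Fin n) → unitInterval) (A : Finset (Fin n)) (o c : Fin n) (j : ℕ)
    (hoA : o ∉ A) (hco : c ≠ o) (hsome : ∃ y : Fin n, y ≠ o ∧ w s(o, y) ≠ 0)
    (hGdom : ∀ y : Fin n, y ≠ o → w s(o, y) ≠ 0 →
      (prodBernoulli w).real {ω : BondConfig (Fin n) | (A.filter fun z => ω ∈ openConn y z).card ≤ j} ≤
        (prodBernoulli w).real {ω : BondConfig (Fin n) | (A.filter fun z => ω ∈ openConn c z).card ≤ j}) :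
    (prodBernoulli w).real {ω : BondConfig (Fin n) |
        1 ≤ (A.filter fun x => ω ∈ openConn o x).card ∧ (A.filter fun x => ω ∈ openConn o x).card ≤ j} ≤
      (prodBernoulli w).real {ω : BondConfig (Fin n) |
        (A.filter fun x => ω ∈ openConn c x).card ≤ j ∧ 1 ≤ (A.filter fun x => ω ∈ openConn o x).card} := by
  set sW : Fin n → ℝ := fun y => (prodBernoulli w).real {ω : BondConfig (Fin n) |
    (A.filter fun z => (openGraph (ω ∩ {e | o ∉ e})).Reachable y z).card ≤ j} with hsW
  set Γ : Finset (Fin n) := Finset.univ.filter fun v => v ≠ o ∧ w s(o, v) ≠ 0 with hΓ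
  have hΓne : Γ.Nonempty := by
    obtain ⟨y, hyo, hwy⟩ := hsome
    exact ⟨y, Finset.mem_filter.2 ⟨Finset.mem_univ _, hyo, hwy⟩⟩
  obtain ⟨g, hgΓ, hgmax⟩ := Finset.exists_max_image Γ sW hΓne
  have hg := Finset.mem_filter.1 hgΓ
  exact tform_of_lightestGate w A o g c j hoA hg.2.1 hco
    (fun y hyo hwy => hgmax y (Finset.mem_filter.2 ⟨Finset.mem_univ _, hyo, hwy⟩)) (hGdom g hg.2.1 hg.2.2)

open CutObserver in
/-- **XZ at the champion whenever a relay K-dominates the gates (every observer).**  Let `o ∉ A`, let the relay `p ∈ A` satisfy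
`Φ_K(y) ≤ Φ_K(p)` for every positive-weight neighbour `y` of `o`, and let `q ∈ A` be a level-`j` champion
(`μ{|π(a)| ≤ j} ≤ μ{|π(q)| ≤ j}` for all `a ∈ A`).  Then `μ{1 ≤ N ≤ j} ≤ μ({|π(q)| ≤ j} ∩ {1 ≤ N})` — the registered stub
`stub_attachedChampion` at this `(w, A, o, q, j)`. [cite: VandenbergHaggstromKahn2005, Thm. 1.5 (p. 7)] -/
theorem attachedChampion_of_relayGateDominator (w : Sym2 (Fin n) → unitInterval) (A : Finset (Fin n)) (o p q : Fin n)
    (j : ℕ) (hoA : o ∉ A) (hpA : p ∈ A) (hqA : q ∈ A)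
    (hdom : ∀ y : Fin n, y ≠ o → w s(o, y) ≠ 0 →
      (prodBernoulli w).real {ω : BondConfig (Fin n) |
          (A.filter fun z => (openGraph (ω ∩ {e | o ∉ e})).Reachable y z).card ≤ j} ≤
        (prodBernoulli w).real {ω : BondConfig (Fin n) |
          (A.filter fun z => (openGraph (ω ∩ {e | o ∉ e})).Reachable p z).card ≤ j})
    (hchamp : ∀ a ∈ A,
      (prodBernoulli w).real {ω : BondConfig (Fin n) | (A.filter fun z => ω ∈ openConn a z).card ≤ j} ≤
        (prodBernoulli w).real {ω : BondConfig (Fin n) | (A.filter fun z => ω ∈ openConn q z).card ≤ j}) :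
    (prodBernoulli w).real {ω : BondConfig (Fin n) |
        1 ≤ (A.filter fun x => ω ∈ openConn o x).card ∧ (A.filter fun x => ω ∈ openConn o x).card ≤ j} ≤
      (prodBernoulli w).real {ω : BondConfig (Fin n) |
        (A.filter fun x => ω ∈ openConn q x).card ≤ j ∧ 1 ≤ (A.filter fun x => ω ∈ openConn o x).card} :=
  tform_of_lightestGate w A o p q j hoA (fun h => hoA (h ▸ hpA)) (fun h => hoA (h ▸ hqA)) hdom (hchamp p hpA)

end Summit.CriticalPhenomena.PercolationContinuityZ3.Theorems

end
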